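import Literature.Analysis.FluidPDE.TaoForcedEnergyBoundDischarge
import HarnessLib

/-!
# Finite energy classical solutions of FORCED Navier–Stokes with `L²` force slices are Leray–Hopf —
# no hypothesis on the force potential (Tao 2011, Lemma 8.1 + Lemma 4.1 (i), general force class)

Analysis/FluidPDE proof file (no definitions, no named facts, no `sorry`). Cell `pub/ns-blowup`, seat
`ns-blowup-lean` g5, for the GENERAL leaf W14 =
`Literature.Analysis.FluidPDE.tao2011_forced_unconditionalUniqueness_velocity` (Tao 2011, Cor. 11.4 WITH
force; support item `TaoForcedUniqueness` of `route-NavierStokesRegularity-PalasekTowerBreakdown`).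
WHAT THIS IS NOT: not a statement about blow-up — Leray–Hopf bookkeeping for smooth finite-energy
solutions of the forced system.

The tree's forced Leray–Hopf packagings (`TaoForcedFiniteEnergyLerayHopfAE`, seat ecbridge-2:
`IsClassicalNSSolutionOn.energyEq_of_finiteEnergy_forced_ae`,
`…isLerayHopfOn_of_finiteEnergy_forced_ae(')`) carry the hypothesis that the force-potential slices
`Δ⁻¹∇·f(t)` lie in `L²` uniformly (`∫|Δ⁻¹∇·f(t)|² ≤ Π`), which holds for Fefferman's Clay class but NOT
for a general smooth force with `sup_t ‖f(t)‖_{H¹} < ∞` — the class of Tao's Cor. 11.4 ("smooth `H¹`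
data") in the tree's rendering `tao2011_forced_unconditionalUniqueness_velocity`. This file removes that
hypothesis: the only place it was used is the force-potential part `X_Φ = ∫ Φ u·∇(θ⁸)`, `Φ = Δ⁻¹∇·f(t)`,
of the pressure flux in the localised energy identity (Tao §8 (61), (64)), and that term is killed — as
in Tao's own proof after the forcing symmetry (31), and exactly as in the tree's discharge of Lemma 8.1
WITH force (`TaoForcedEnergyBoundDischarge`, seat lit g9) — by the pointwise domination
`|Φ| ≤ ω₃⁻¹ I₁|f(t)|`, the Hardy–Littlewood–Sobolev inequality `‖I₁g‖_{L⁶(ℝ³)} ≲ ‖g‖_{L²}`, Hölder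
`L⁶ × L² × L³` on the shell carrying `∇θ` (`enorm_integral_forcePotential_mul_fderiv_cutoff_le`), and
the vanishing of the `L⁶` tails integrated in time (`tendsto_lintegral_tail_rieszPotential`).

* `IsClassicalNSSolutionOn.dissipation_lt_top_of_forceL2` — finite dissipation `∫₀ᵀ∫|∇u|² < ∞` for a
  finite energy classical solution whose force has slices uniformly in `L²` (from the tree's THEOREM
  `tao2011_forced_finiteEnergy_energyBound_holds`, Lemma 8.1 WITH force);
* `IsClassicalNSSolutionOn.energyEq_of_finiteEnergy_forced_L2` — the forced energy EQUALITY
  `½‖u(t)‖₂² + ν∫ₛᵗ∫|∇u|² = ½‖u(s)‖₂² + ∫ₛᵗ∫⟪f,u⟫`, `0 ≤ s ≤ t ≤ T`, given `∇u ∈ L²_{t,x}`,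
  `u ∈ L³_{t,x}` — verbatim the proof of `energyEq_of_finiteEnergy_forced_ae` (cut-offs
  `θ⁸_{4(n+1),n+1}`, dominated convergence in every term) with step (d), the pressure flux, re-done:
  `p = p̃[u] + Δ⁻¹∇·f + C(t)` for a.e. `t` by the PROVED corrected Lemma 4.1 (i)
  (`tao2011_forced_pressure_normalisation_ae_holds`), `p̃` by the PROVED estimate of `X₅`
  (`tao2011_pressureTerm_estimate_holds`), `Δ⁻¹∇·f` by the HLS tail bound;
* `IsClassicalNSSolutionOn.isLerayHopfOn_of_finiteEnergy_forced_L2'` (core, `∇u ∈ L²_{t,x}` given) and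
  **`IsClassicalNSSolutionOn.isLerayHopfOn_of_finiteEnergy_forced_L2`**: a classical solution of the
  forced system on `[0,T] × ℝ³` (`ν > 0`) with `∫|f(t)|² ≤ C_f < ∞` and `sup_t ∫|u(t)|² < ∞` is a
  Leray–Hopf weak solution on `[0, T)` from `u(0)` with force `f` (energy equality with the work term)
  and `u ∈ C([0,T]; L²)` — NO fact hypothesis, NO potential hypothesis;
* `IsClassicalNSSolutionOn.force_prod_aestronglyMeasurable`, `…force_prod_eLpNorm_two_lt_top` — the
  force of a classical solution on the closed slab with `∫|f(t)|² ≤ C_f` is jointly measurable and in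
  `L²((0,T) × ℝ³)` (the form Tao's Prop. 9.1 WITH force, `lintegral_eLpNorm_top_lt_top_forced`, asks).

## References

* T. Tao, *Localisation and compactness properties of the Navier–Stokes global regularity
  problem*, Anal. PDE 6 (2013) 25–107 = arXiv:1108.1165 (`Tao2011`): Lemma 8.1 (arXiv Lemma 44) and
  its proof §8 (53)–(65), pp. 24–26; Lemma 4.1 (i) (arXiv Lemma 25 (i)) and Remark 4.2, p. 14; (6)–(9).
* E. M. Stein, *Singular integrals and differentiability properties of functions*, Princeton (1970),
  Ch. V §1.2 Thm. 1 (Hardy–Littlewood–Sobolev). [Stein1971]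
* J. Leray, Acta Math. 63 (1934), §17 (3.4). [Leray1934]
-/

noncomputable section

open MeasureTheory Set Filter Topology Metric Function
open scoped ENNReal NNReal RealInnerProductSpace

namespace Literature.Analysis.FluidPDE

open SingularIntegrals

/-! ## 1. The force of a classical solution on the closed slab; finite dissipation (Lemma 8.1 WITH force) -/

section Force

variable {T ν : ℝ} {f u : ℝ → EuclideanSpace ℝ (Fin 3) → EuclideanSpace ℝ (Fin 3)}
  {p : ℝ → EuclideanSpace ℝ (Fin 3) → ℝ}

/-- **The force of a classical solution on `[0,T] × ℝ³` is jointly measurable on `(0,T) × ℝ³`** (it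
is continuous on the closed slab, being read off the momentum equation). [cite: Tao2011, (3) p. 2 and (6) p. 3] -/
theorem IsClassicalNSSolutionOn.force_prod_aestronglyMeasurable
    (h : IsClassicalNSSolutionOn (Icc 0 T) ν f u p) (hT : 0 < T) :
    AEStronglyMeasurable (uncurry f)
      ((volume.restrict (Ioo 0 T)).prod (volume : Measure (EuclideanSpace ℝ (Fin 3)))) := by
  have hc : ContinuousOn (uncurry f) (Ioo 0 T ×ˢ (univ : Set (EuclideanSpace ℝ (Fin 3)))) :=
    (h.continuousOn_force (uniqueDiffOn_Icc hT)).mono (prod_mono Ioo_subset_Icc_self subset_rfl)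
  have h1 : AEStronglyMeasurable (uncurry f)
      (((volume : Measure ℝ).prod (volume : Measure (EuclideanSpace ℝ (Fin 3)))).restrict
        (Ioo 0 T ×ˢ univ)) :=
    hc.aestronglyMeasurable (measurableSet_Ioo.prod MeasurableSet.univ)
  rw [← Measure.prod_restrict, Measure.restrict_univ] at h1
  exact h1

/-- **A force with slices uniformly in `L²` on `[0,T]` is in `L²((0,T) × ℝ³)`** (Tonelli; the slab
has finite length). [cite: Tao2011, (6) p. 3] -/
theorem IsClassicalNSSolutionOn.force_prod_eLpNorm_two_lt_top
    (h : IsClassicalNSSolutionOn (Icc 0 T) ν f u p) (hT : 0 < T)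
    {Cf : ℝ≥0∞} (hCft : Cf ≠ ⊤) (hCf : ∀ t ∈ Icc 0 T, ∫⁻ x, ‖f t x‖ₑ ^ 2 ≤ Cf) :
    eLpNorm (uncurry f) 2
      ((volume.restrict (Ioo 0 T)).prod (volume : Measure (EuclideanSpace ℝ (Fin 3)))) < ⊤ := by
  have hm := h.force_prod_aestronglyMeasurable hT
  rw [eLpNorm_lt_top_iff_lintegral_rpow_enorm_lt_top two_ne_zero ENNReal.ofNat_ne_top,
    ENNReal.toReal_ofNat, lintegral_prod _ (hm.enorm.pow_const _)]
  have hin : ∀ t ∈ Ioo 0 T, ∫⁻ x, ‖uncurry f (t, x)‖ₑ ^ (2 : ℝ) ≤ Cf := by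
    intro t ht
    refine le_trans (le_of_eq (lintegral_congr fun x => ?_)) (hCf t (Ioo_subset_Icc_self ht))
    simp only [uncurry, ENNReal.rpow_two]
  calc ∫⁻ t in Ioo 0 T, ∫⁻ x, ‖uncurry f (t, x)‖ₑ ^ (2 : ℝ)
      ≤ ∫⁻ _ in Ioo 0 T, Cf := setLIntegral_mono' measurableSet_Ioo fun t ht => hin t ht
    _ < ⊤ := by
        rw [setLIntegral_const, Real.volume_Ioo]
        exact ENNReal.mul_lt_top hCft.lt_top ENNReal.ofReal_lt_top

/-- **Lemma 8.1 WITH force: finite dissipation, general force class.** A classical solution of the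
forced system (`ν > 0`) on `[0,T] × ℝ³`, `T > 0`, with finite energy `sup_t ∫|u(t)|² < ∞` and force
slices uniformly in `L²` (`∫|f(t)|² ≤ C_f < ∞`; no hypothesis on `Δ⁻¹∇·f`) has `∫₀ᵀ∫|∇u|² < ∞` — the
tree's THEOREM `tao2011_forced_finiteEnergy_energyBound_holds` (Tao 2011, Lemma 8.1 = arXiv Lemma 44,
PROVED for smooth forces of finite `L¹_t L²_x` norm):
`ν∫₀ᵀ∫|∇u|² ≤ C ((∫|u₀|²)^{1/2} + ∫₀ᵀ‖f‖_{L²})² < ∞`. [cite: Tao2011, Lemma 8.1 (arXiv Lemma 44), p. 24] -/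
theorem IsClassicalNSSolutionOn.dissipation_lt_top_of_forceL2
    (h : IsClassicalNSSolutionOn (Icc 0 T) ν f u p) (hν : 0 < ν) (hT : 0 < T)
    {Cf : ℝ≥0∞} (hCft : Cf ≠ ⊤) (hCf : ∀ t ∈ Icc 0 T, ∫⁻ x, ‖f t x‖ₑ ^ 2 ≤ Cf)
    (hE : ∃ A : ℝ≥0∞, A < ⊤ ∧ ∀ t ∈ Icc 0 T, ∫⁻ x, ‖u t x‖ₑ ^ 2 ≤ A) :
    ∫⁻ t in Ioo 0 T, ∫⁻ x, ENNReal.ofReal (frobeniusNormSq (fderiv ℝ (u t) x)) < ⊤ := by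
  obtain ⟨C, hC, H⟩ := tao2011_forced_finiteEnergy_energyBound_holds
  obtain ⟨A, hAt, hA⟩ := hE
  have hU : UniqueDiffOn ℝ (Icc 0 T) := uniqueDiffOn_Icc hT
  have hfs : IsSmoothSpaceTimeOn (Icc 0 T) f := h.isSmoothSpaceTimeOn_force hU
  have hfE : ∫⁻ t in Icc 0 T, (∫⁻ x, ‖f t x‖ₑ ^ 2) ^ (1 / 2 : ℝ) < ⊤ := lintegral_sqrt_force_lt_top hCft hCf
  have hE' : ∃ A : ℝ≥0, ∀ t ∈ Icc 0 T, ∫⁻ x, ‖u t x‖ₑ ^ 2 ≤ A :=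
    ⟨A.toNNReal, fun t ht => (hA t ht).trans (ENNReal.coe_toNNReal hAt.ne).ge⟩
  have key := (H hν hT h hfs hfE hE').2
  -- the right-hand side is finite
  have h0 : ∫⁻ x, ‖u 0 x‖ₑ ^ 2 ≤ A := hA 0 ⟨le_rfl, hT.le⟩
  have hsum : (∫⁻ x, ‖u 0 x‖ₑ ^ 2) ^ (1 / 2 : ℝ) +
      ∫⁻ t in Icc 0 T, (∫⁻ x, ‖f t x‖ₑ ^ 2) ^ (1 / 2 : ℝ) ≠ ⊤ :=
    ENNReal.add_ne_top.2 ⟨ENNReal.rpow_ne_top_of_nonneg (by norm_num) (h0.trans_lt hAt).ne, hfE.ne⟩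
  have hrhs : C * ((∫⁻ x, ‖u 0 x‖ₑ ^ 2) ^ (1 / 2 : ℝ) +
      ∫⁻ t in Icc 0 T, (∫⁻ x, ‖f t x‖ₑ ^ 2) ^ (1 / 2 : ℝ)) ^ 2 < ⊤ :=
    ENNReal.mul_lt_top hC (ENNReal.pow_lt_top hsum.lt_top)
  have hprod : ENNReal.ofReal ν *
      ∫⁻ t in Ioo 0 T, ∫⁻ x, ENNReal.ofReal (frobeniusNormSq (fderiv ℝ (u t) x)) < ⊤ :=
    key.trans_lt hrhs
  have hν' : ENNReal.ofReal ν ≠ 0 := (ENNReal.ofReal_pos.2 hν).ne'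
  rcases ENNReal.mul_lt_top_iff.1 hprod with h2 | h2 | h2
  · exact h2.2
  · exact absurd h2 hν'
  · rw [h2]; exact ENNReal.zero_lt_top

end Force

/-! ## 2. The forced energy equality without the potential hypothesis -/

section Energy

variable {T ν : ℝ} {f u : ℝ → EuclideanSpace ℝ (Fin 3) → EuclideanSpace ℝ (Fin 3)}
  {p : ℝ → EuclideanSpace ℝ (Fin 3) → ℝ}

set_option maxHeartbeats 400000 in
/-- **The energy equality for finite energy classical solutions WITH force — general force class**
(Tao 2011, Lemma 8.1, sharp form, with Lemma 4.1 (i); Leray 1934, (3.4)). Let `(u, p)` be a classical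
solution of the forced system on `[0, T] × ℝ³` (`ν > 0`) with `sup_t ∫|u(t)|² ≤ A < ⊤`,
`∇u ∈ L²_{t,x}`, `u ∈ L³_{t,x}` and force slices `∫|f(t)|² ≤ C_f < ⊤` — NO hypothesis on the force
potential `Δ⁻¹∇·f`. Then for `0 ≤ s ≤ t ≤ T`:
`½‖u(t)‖₂² + ν∫ₛᵗ∫|∇u|² = ½‖u(s)‖₂² + ∫ₛᵗ∫⟪f, u⟫`. Proof: verbatim that of
`energyEq_of_finiteEnergy_forced_ae` (localised identity (61) along Tao's cut-offs `θ⁸_{4(n+1),n+1}`,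
dominated convergence in every term), except for the pressure flux `∫∫ p u·∇(θ⁸)`: for a.e. `τ`,
`p = p̃[u] + Δ⁻¹∇·f + C(τ)` (corrected Lemma 4.1 (i), the tree's theorem
`tao2011_forced_pressure_normalisation_ae_holds`); the `p̃` part is Tao's `X₅`
(`tao2011_pressureTerm_estimate_holds`); the `Δ⁻¹∇·f` part is bounded per slice by
`32 C₁ ω₃⁻¹ A^{1/2} |B̄₁|^{1/3} ‖I₁|f(τ)|‖_{L⁶(|x|² ≥ 12(n+1)²)}` (`|Δ⁻¹∇·f| ≤ ω₃⁻¹ I₁|f|`, Hölder on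
the shell, `enorm_integral_forcePotential_mul_fderiv_cutoff_le`) whose time integral tends to `0`
(Hardy–Littlewood–Sobolev + dominated convergence, `tendsto_lintegral_tail_rieszPotential`).
[cite: Tao2011, Lemma 8.1 (proof, §8, (54), (61)–(65)) with Lemma 4.1 (i) and (31)] -/
theorem IsClassicalNSSolutionOn.energyEq_of_finiteEnergy_forced_L2
    (h : IsClassicalNSSolutionOn (Icc 0 T) ν f u p) (hν : 0 < ν) (hT : 0 < T)
    {Cf : ℝ≥0∞} (hCft : Cf ≠ ⊤) (hCf : ∀ t ∈ Icc 0 T, ∫⁻ x, ‖f t x‖ₑ ^ 2 ≤ Cf)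
    {A : ℝ≥0∞} (hAt : A ≠ ⊤) (hA : ∀ t ∈ Icc 0 T, ∫⁻ x, ‖u t x‖ₑ ^ 2 ≤ A)
    (hgrad : ∫⁻ τ in Ioo 0 T, ∫⁻ x, ENNReal.ofReal (frobeniusNormSq (fderiv ℝ (u τ) x)) < ⊤)
    (hu₃ : ∫⁻ τ in Ioo 0 T, ∫⁻ x, ‖u τ x‖ₑ ^ (3 : ℕ) < ⊤)
    {s t : ℝ} (hs : 0 ≤ s) (hst : s ≤ t) (ht : t ≤ T) :
    VectorCalculus.kineticEnergy (u t) +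
      ν * (∫⁻ τ in Ioo s t, ∫⁻ x, ENNReal.ofReal (frobeniusNormSq (fderiv ℝ (u τ) x))).toReal =
      VectorCalculus.kineticEnergy (u s) + ∫ τ in Ioo s t, ∫ x, ⟪f τ x, u τ x⟫ := by
  set b := stdOrthonormalBasis ℝ (EuclideanSpace ℝ (Fin 3))
  have hU : UniqueDiffOn ℝ (Icc 0 T) := uniqueDiffOn_Icc hT
  have htI : t ∈ Icc 0 T := ⟨hs.trans hst, ht⟩
  have hsI : s ∈ Icc 0 T := ⟨hs, hst.trans ht⟩
  have hIcc : ∀ {τ}, τ ∈ Ioo s t → τ ∈ Icc 0 T := fun hτ => ⟨hs.trans hτ.1.le, hτ.2.le.trans ht⟩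
  have hmem : ∀ τ ∈ Icc 0 T, MemLp (u τ) 2 volume := fun τ hτ =>
    memLp_two_of_lintegral_lt_top (h.contDiff_velocity hτ).continuous ((hA τ hτ).trans_lt hAt.lt_top)
  have hM : ∀ τ ∈ Icc 0 T, eEnergy (u τ) ≤ A := fun τ hτ => hA τ hτ
  have hfs : IsSmoothSpaceTimeOn (Icc 0 T) f := h.isSmoothSpaceTimeOn_force hU
  -- joint continuity on `[s, t] × E`
  have hsub : Icc s t ×ˢ (univ : Set (EuclideanSpace ℝ (Fin 3))) ⊆ Icc 0 T ×ˢ univ :=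
    prod_mono (Icc_subset_Icc hs ht) Subset.rfl
  have cu : ContinuousOn (fun z : ℝ × EuclideanSpace ℝ (Fin 3) => u z.1 z.2) (Icc s t ×ˢ univ) :=
    h.smooth_velocity.continuousOn.mono hsub
  have cDu : ContinuousOn (fun z : ℝ × EuclideanSpace ℝ (Fin 3) => fderiv ℝ (u z.1) z.2)
      (Icc s t ×ˢ univ) :=
    (h.smooth_velocity.fderiv_slice hU).continuousOn.mono hsub
  have cf : ContinuousOn (fun z : ℝ × EuclideanSpace ℝ (Fin 3) => f z.1 z.2) (Icc s t ×ˢ univ) :=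
    (h.continuousOn_force hU).mono hsub
  -- the cut-offs
  obtain ⟨C, hC0', hfam⟩ := taoCutoff_family
  have hC0 : 0 ≤ C := hC0'.le
  have hRpos : ∀ n : ℕ, (0 : ℝ) < n + 1 := fun n => Nat.cast_add_one_pos n
  set φ : ℕ → EuclideanSpace ℝ (Fin 3) → ℝ := fun n x =>
    taoCutoff (4 * ((n : ℝ) + 1)) ((n : ℝ) + 1) x ^ 8 with hφdef
  have hφ1 : ∀ n, ContDiff ℝ 1 (φ n) := fun n => (hfam n).1
  have hφc : ∀ n, HasCompactSupport (φ n) := fun n => (hfam n).2.1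
  have hφle : ∀ n x, |φ n x| ≤ 1 := fun n => (hfam n).2.2.1
  have hφlim : ∀ x, Tendsto (fun n => φ n x) atTop (𝓝 1) := by
    intro x
    obtain ⟨N, hN⟩ := exists_nat_ge (‖x‖ / 3)
    refine tendsto_atTop_of_eventually_const (i₀ := N) fun n hn => ?_
    refine (hfam n).2.2.2.1 x ?_
    have : (N : ℝ) ≤ n := by exact_mod_cast hn
    rw [div_le_iff₀ (by norm_num : (0 : ℝ) < 3)] at hN
    linarith
  have hDφv : ∀ n x v, |fderiv ℝ (φ n) x v| ≤ C / ((n : ℝ) + 1) * ‖v‖ := fun n => (hfam n).2.2.2.2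
  have hc' : ∀ n : ℕ, (0 : ℝ) ≤ C / ((n : ℝ) + 1) := fun n => div_nonneg hC0 (hRpos n).le
  have hrate : ∀ K : ℝ, Tendsto (fun n : ℕ => K * (1 / ((n : ℝ) + 1))) atTop (𝓝 0) := fun K => by
    simpa using (tendsto_one_div_add_atTop_nhds_zero_nat (𝕜 := ℝ)).const_mul K
  -- the identity for each `n`
  have hid := fun n => h.energy_balance_cutoff hT (hφ1 n) (hφc n) hs hst ht
  -- (a) the kinetic terms
  have limE : ∀ {r}, r ∈ Icc 0 T →
      Tendsto (fun n => 2⁻¹ * ∫ x, φ n x * ‖u r x‖ ^ 2) atTop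
        (𝓝 (VectorCalculus.kineticEnergy (u r))) := by
    intro r hr
    have hur : Continuous (u r) := (h.contDiff_velocity hr).continuous
    refine Tendsto.const_mul _ (tendsto_integral_of_dominated_convergence (fun x => ‖u r x‖ ^ 2)
      ?_ ((hmem r hr).integrable_norm_pow two_ne_zero) ?_ ?_)
    · exact fun n => ((hφ1 n).continuous.mul (hur.norm.pow 2)).aestronglyMeasurable
    · refine fun n => Eventually.of_forall fun x => ?_
      rw [Real.norm_eq_abs, abs_mul, abs_of_nonneg (sq_nonneg ‖u r x‖)]
      exact mul_le_of_le_one_left (sq_nonneg _) (hφle n x)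
    · exact Eventually.of_forall fun x => by simpa using (hφlim x).mul_const (‖u r x‖ ^ 2)
  -- (b) the transported kinetic energy `½ ∫∫ (Dφ·u)|u|²` is `O(1/n)`
  have lim1 : Tendsto (fun n => ∫ τ in Ioo s t, ∫ x, fderiv ℝ (φ n) x (u τ x) * ‖u τ x‖ ^ 2)
      atTop (𝓝 0) := by
    set L := ∫⁻ τ in Ioo 0 T, ∫⁻ x, ‖u τ x‖ₑ ^ (3 : ℕ) with hL
    have hLt : L ≠ ⊤ := hu₃.ne
    refine squeeze_zero_norm (a := fun n : ℕ => C * L.toReal * (1 / ((n : ℝ) + 1)))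
      (fun n => ?_) (hrate _)
    have hpt : ∀ τ x, ‖fderiv ℝ (φ n) x (u τ x) * ‖u τ x‖ ^ 2‖ₑ ≤
        ENNReal.ofReal (C / ((n : ℝ) + 1)) * ‖u τ x‖ₑ ^ (3 : ℕ) := fun τ x => by
      rw [Real.enorm_eq_ofReal_abs, ← ofReal_norm, ← ENNReal.ofReal_pow (norm_nonneg _),
        ← ENNReal.ofReal_mul (hc' n)]
      refine ENNReal.ofReal_le_ofReal ?_
      rw [abs_mul, abs_of_nonneg (sq_nonneg ‖u τ x‖)]
      calc |fderiv ℝ (φ n) x (u τ x)| * ‖u τ x‖ ^ 2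
          ≤ C / ((n : ℝ) + 1) * ‖u τ x‖ * ‖u τ x‖ ^ 2 := by gcongr; exact hDφv n x _
        _ = C / ((n : ℝ) + 1) * ‖u τ x‖ ^ 3 := by ring
    have hle : ∫⁻ τ in Ioo s t, ∫⁻ x, ‖fderiv ℝ (φ n) x (u τ x) * ‖u τ x‖ ^ 2‖ₑ ≤
        ENNReal.ofReal (C / ((n : ℝ) + 1)) * L := by
      calc ∫⁻ τ in Ioo s t, ∫⁻ x, ‖fderiv ℝ (φ n) x (u τ x) * ‖u τ x‖ ^ 2‖ₑ
          ≤ ∫⁻ τ in Ioo s t, ∫⁻ x, ENNReal.ofReal (C / ((n : ℝ) + 1)) * ‖u τ x‖ₑ ^ (3 : ℕ) :=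
            lintegral_mono fun τ => lintegral_mono fun x => hpt τ x
        _ = ENNReal.ofReal (C / ((n : ℝ) + 1)) * ∫⁻ τ in Ioo s t, ∫⁻ x, ‖u τ x‖ₑ ^ (3 : ℕ) := by
            simp only [lintegral_const_mul' _ _ ENNReal.ofReal_ne_top]
        _ ≤ ENNReal.ofReal (C / ((n : ℝ) + 1)) * L :=
            mul_le_mul_right (lintegral_Ioo_mono hs ht) _
    refine (norm_integral_integral_le_of_lintegral_le
      (G := fun z : ℝ × EuclideanSpace ℝ (Fin 3) => fderiv ℝ (φ n) z.2 (u z.1 z.2) * ‖u z.1 z.2‖ ^ 2)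
      (ENNReal.mul_ne_top ENNReal.ofReal_ne_top hLt) hle).trans_eq ?_
    rw [ENNReal.toReal_mul, ENNReal.toReal_ofReal (hc' n)]
    ring
  -- (c) the viscous cross term `ν ∫∫ Σᵢ ∂ᵢφ ⟪∂ᵢu, u⟫` is `O(1/n)` (Young's inequality)
  have lim3 : Tendsto (fun n => ∫ τ in Ioo s t, ∫ x, ∑ i, fderiv ℝ (φ n) x (b i) *
      ⟪fderiv ℝ (u τ) x (b i), u τ x⟫) atTop (𝓝 0) := by
    set Lg := ∫⁻ τ in Ioo 0 T, ∫⁻ x, ENNReal.ofReal (frobeniusNormSq (fderiv ℝ (u τ) x)) with hLg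
    set d : ℕ := (Finset.univ : Finset (Fin (Module.finrank ℝ (EuclideanSpace ℝ (Fin 3))))).card
      with hd
    set B : ℝ≥0∞ := Lg + (d : ℝ≥0∞) * A * ENNReal.ofReal T with hB
    have hBt : B ≠ ⊤ := ENNReal.add_ne_top.2 ⟨hgrad.ne, ENNReal.mul_ne_top
      (ENNReal.mul_ne_top (ENNReal.natCast_ne_top d) hAt) ENNReal.ofReal_ne_top⟩
    refine squeeze_zero_norm (a := fun n : ℕ => C * B.toReal * (1 / ((n : ℝ) + 1)))
      (fun n => ?_) (hrate _)
    -- pointwise Young bound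
    have hpt : ∀ τ x, ‖∑ i, fderiv ℝ (φ n) x (b i) * ⟪fderiv ℝ (u τ) x (b i), u τ x⟫‖ₑ ≤
        ENNReal.ofReal (C / ((n : ℝ) + 1)) *
          (ENNReal.ofReal (frobeniusNormSq (fderiv ℝ (u τ) x)) + d * ‖u τ x‖ₑ ^ 2) := by
      intro τ x
      have hreal : |∑ i, fderiv ℝ (φ n) x (b i) * ⟪fderiv ℝ (u τ) x (b i), u τ x⟫| ≤
          C / ((n : ℝ) + 1) * (frobeniusNormSq (fderiv ℝ (u τ) x) + d * ‖u τ x‖ ^ 2) := by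
        calc |∑ i, fderiv ℝ (φ n) x (b i) * ⟪fderiv ℝ (u τ) x (b i), u τ x⟫|
            ≤ ∑ i, |fderiv ℝ (φ n) x (b i) * ⟪fderiv ℝ (u τ) x (b i), u τ x⟫| :=
              Finset.abs_sum_le_sum_abs _ _
          _ ≤ ∑ i, C / ((n : ℝ) + 1) * (‖fderiv ℝ (u τ) x (b i)‖ ^ 2 + ‖u τ x‖ ^ 2) := by
              refine Finset.sum_le_sum fun i _ => ?_
              rw [abs_mul]
              have h1 : |fderiv ℝ (φ n) x (b i)| ≤ C / ((n : ℝ) + 1) := by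
                simpa [b.orthonormal.1 i] using hDφv n x (b i)
              have h2 : |⟪fderiv ℝ (u τ) x (b i), u τ x⟫| ≤
                  ‖fderiv ℝ (u τ) x (b i)‖ ^ 2 + ‖u τ x‖ ^ 2 :=
                (abs_real_inner_le_norm _ _).trans (by
                  nlinarith [sq_nonneg (‖fderiv ℝ (u τ) x (b i)‖ - ‖u τ x‖),
                    norm_nonneg (fderiv ℝ (u τ) x (b i)), norm_nonneg (u τ x)])
              exact mul_le_mul h1 h2 (abs_nonneg _) (hc' n)
          _ = C / ((n : ℝ) + 1) * (frobeniusNormSq (fderiv ℝ (u τ) x) + d * ‖u τ x‖ ^ 2) := by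
              rw [← Finset.mul_sum, Finset.sum_add_distrib, Finset.sum_const, nsmul_eq_mul,
                frobeniusNormSq_eq_sum b]
      rw [Real.enorm_eq_ofReal_abs]
      refine (ENNReal.ofReal_le_ofReal hreal).trans_eq ?_
      rw [ENNReal.ofReal_mul (hc' n), ENNReal.ofReal_add (frobeniusNormSq_nonneg _) (by positivity),
        ENNReal.ofReal_mul (Nat.cast_nonneg _), ENNReal.ofReal_natCast, ← ofReal_norm,
        ← ENNReal.ofReal_pow (norm_nonneg _)]
    -- inner integrals, `τ ∈ (s, t)`
    have hin : ∀ τ ∈ Ioo s t,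
        ∫⁻ x, ‖∑ i, fderiv ℝ (φ n) x (b i) * ⟪fderiv ℝ (u τ) x (b i), u τ x⟫‖ₑ ≤
          ENNReal.ofReal (C / ((n : ℝ) + 1)) *
            ((∫⁻ x, ENNReal.ofReal (frobeniusNormSq (fderiv ℝ (u τ) x))) + d * A) := by
      intro τ hτ
      have hτI := hIcc hτ
      have hmeas : AEMeasurable (fun x => ENNReal.ofReal (frobeniusNormSq (fderiv ℝ (u τ) x)))
          (volume : Measure (EuclideanSpace ℝ (Fin 3))) :=
        (ENNReal.continuous_ofReal.comp (LerayHopfProofs.continuous_frobeniusNormSq.comp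
          ((h.contDiff_velocity hτI).continuous_fderiv (by simp)))).aemeasurable
      calc ∫⁻ x, ‖∑ i, fderiv ℝ (φ n) x (b i) * ⟪fderiv ℝ (u τ) x (b i), u τ x⟫‖ₑ
          ≤ ∫⁻ x, ENNReal.ofReal (C / ((n : ℝ) + 1)) *
              (ENNReal.ofReal (frobeniusNormSq (fderiv ℝ (u τ) x)) + d * ‖u τ x‖ₑ ^ 2) :=
            lintegral_mono fun x => hpt τ x
        _ = ENNReal.ofReal (C / ((n : ℝ) + 1)) *
              ((∫⁻ x, ENNReal.ofReal (frobeniusNormSq (fderiv ℝ (u τ) x))) +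
                d * ∫⁻ x, ‖u τ x‖ₑ ^ 2) := by
            rw [lintegral_const_mul' _ _ ENNReal.ofReal_ne_top, lintegral_add_left' hmeas,
              lintegral_const_mul' _ _ (ENNReal.natCast_ne_top d)]
        _ ≤ ENNReal.ofReal (C / ((n : ℝ) + 1)) *
              ((∫⁻ x, ENNReal.ofReal (frobeniusNormSq (fderiv ℝ (u τ) x))) + d * A) := by
            gcongr
            exact hM τ hτI
    have hle : ∫⁻ τ in Ioo s t,
        ∫⁻ x, ‖∑ i, fderiv ℝ (φ n) x (b i) * ⟪fderiv ℝ (u τ) x (b i), u τ x⟫‖ₑ ≤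
          ENNReal.ofReal (C / ((n : ℝ) + 1)) * B := by
      calc ∫⁻ τ in Ioo s t, ∫⁻ x, ‖∑ i, fderiv ℝ (φ n) x (b i) * ⟪fderiv ℝ (u τ) x (b i), u τ x⟫‖ₑ
          ≤ ∫⁻ τ in Ioo s t, ENNReal.ofReal (C / ((n : ℝ) + 1)) *
              ((∫⁻ x, ENNReal.ofReal (frobeniusNormSq (fderiv ℝ (u τ) x))) + d * A) :=
            setLIntegral_mono' measurableSet_Ioo hin
        _ = ENNReal.ofReal (C / ((n : ℝ) + 1)) *
              ((∫⁻ τ in Ioo s t, ∫⁻ x, ENNReal.ofReal (frobeniusNormSq (fderiv ℝ (u τ) x))) +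
                d * A * volume (Ioo s t)) := by
            rw [lintegral_const_mul' _ _ ENNReal.ofReal_ne_top, lintegral_add_right _ measurable_const,
              setLIntegral_const]
        _ ≤ ENNReal.ofReal (C / ((n : ℝ) + 1)) * B := by
            rw [hB, Real.volume_Ioo]
            gcongr
            · exact lintegral_Ioo_mono hs ht
            · linarith
    refine (norm_integral_integral_le_of_lintegral_le
      (G := fun z : ℝ × EuclideanSpace ℝ (Fin 3) => ∑ i, fderiv ℝ (φ n) z.2 (b i) *
        ⟪fderiv ℝ (u z.1) z.2 (b i), u z.1 z.2⟫)
      (ENNReal.mul_ne_top ENNReal.ofReal_ne_top hBt) hle).trans_eq ?_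
    rw [ENNReal.toReal_mul, ENNReal.toReal_ofReal (hc' n)]
    ring
  -- (d) the pressure flux `∫∫ p (Dφ·u) → 0`: corrected Lemma 4.1 (i) WITH force (PROVED), the estimate
  -- of `X₅` (PROVED), and — for the force-potential part, with NO `L²` hypothesis on `Δ⁻¹∇·f` — the
  -- Hardy–Littlewood–Sobolev tail bound of `TaoForcedEnergyBoundDischarge`
  have lim4 : Tendsto (fun n => ∫ τ in Ioo s t, ∫ x, p τ x * fderiv ℝ (φ n) x (u τ x))
      atTop (𝓝 0) := by
    have hE' : ∃ C : ℝ≥0, ∀ τ ∈ Icc 0 T, ∫⁻ x, ‖u τ x‖ₑ ^ 2 ≤ C :=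
      ⟨A.toNNReal, fun τ hτ => (hA τ hτ).trans (ENNReal.coe_toNNReal hAt).ge⟩
    have hfE : ∫⁻ τ in Icc 0 T, (∫⁻ x, ‖f τ x‖ₑ ^ 2) ^ (1 / 2 : ℝ) < ⊤ :=
      lintegral_sqrt_force_lt_top hCft hCf
    obtain ⟨Cp, -, hae⟩ := tao2011_forced_pressure_normalisation_ae_holds hν hT h hfs hfE hE'
    obtain ⟨C₅, hC₅0, h5⟩ := tao2011_pressureTerm_estimate_holds
    obtain ⟨C₁, hC₁0, hC₁⟩ := exists_norm_fderiv_taoCutoff_le (E := EuclideanSpace ℝ (Fin 3))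
    set Ar : ℝ := Real.sqrt A.toReal with hAr
    have hAr0 : 0 ≤ Ar := Real.sqrt_nonneg _
    have hAr2 : ENNReal.ofReal (Ar ^ 2) = A := by
      rw [hAr, Real.sq_sqrt ENNReal.toReal_nonneg, ENNReal.ofReal_toReal hAt]
    -- the constant of the force-potential term: `8(C₁/r) ω₃⁻¹ R A^{1/2} |B̄₁|^{1/3}` with `R = 4r`
    have hω : 0 < unitSphereArea (EuclideanSpace ℝ (Fin 3)) := unitSphereArea_pos
    have hV3t : volume (closedBall (0 : EuclideanSpace ℝ (Fin 3)) 1) ^ (1 / 3 : ℝ) ≠ ⊤ :=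
      ENNReal.rpow_ne_top_of_nonneg (by norm_num) measure_closedBall_lt_top.ne
    set KΦ : ℝ≥0∞ := ENNReal.ofReal (32 * C₁ * (unitSphereArea (EuclideanSpace ℝ (Fin 3)))⁻¹ * Ar) *
      volume (closedBall (0 : EuclideanSpace ℝ (Fin 3)) 1) ^ (1 / 3 : ℝ) with hKΦ
    have hKΦt : KΦ ≠ ⊤ := ENNReal.mul_ne_top ENNReal.ofReal_ne_top hV3t
    -- the `L⁶` tail of `I₁|f(τ)|` outside the shell of `φ_n` (`R(R - r) = 12(n+1)²`), integrated in time
    set Gf : ℕ → ℝ → ℝ≥0∞ := fun n τ =>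
      (∫⁻ x in {y : EuclideanSpace ℝ (Fin 3) |
          4 * ((n : ℝ) + 1) * (4 * ((n : ℝ) + 1) - ((n : ℝ) + 1)) ≤ ‖y‖ ^ 2},
        rieszPotential volume 1 (fun y => ‖f τ y‖ₑ) x ^ (6 : ℝ)) ^ (1 / 6 : ℝ) with hGf
    set Ψ : ℕ → ℝ≥0∞ := fun n => ∫⁻ τ in Ioo 0 T, Gf n τ with hΨ
    have hΨ0 : Tendsto Ψ atTop (𝓝 0) := by
      have hlit := tendsto_lintegral_tail_rieszPotential hfs hfE
      refine tendsto_of_tendsto_of_tendsto_of_le_of_le tendsto_const_nhds hlit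
        (fun _ => zero_le) fun n => ?_
      simp only [hΨ, hGf]
      refine lintegral_mono fun τ => ENNReal.rpow_le_rpow (lintegral_mono_set fun y hy => ?_)
        (by norm_num)
      simp only [mem_setOf_eq] at hy ⊢
      nlinarith [hy, sq_nonneg ((n : ℝ) + 1)]
    -- the dissipation slices and their measurability in time (Tonelli, joint continuity)
    set G : ℝ → ℝ≥0∞ := fun τ => ∫⁻ x, ENNReal.ofReal (frobeniusNormSq (fderiv ℝ (u τ) x)) with hG
    set Dst : ℝ≥0∞ := ∫⁻ τ in Ioo s t, G τ with hDst
    have hDst : Dst ≠ ⊤ := ((lintegral_Ioo_mono hs ht).trans_lt hgrad).ne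
    have hGm : AEMeasurable G (volume.restrict (Ioo s t)) := by
      have cG : ContinuousOn (fun z : ℝ × EuclideanSpace ℝ (Fin 3) =>
          frobeniusNormSq (fderiv ℝ (u z.1) z.2)) (Icc s t ×ˢ univ) :=
        LerayHopfProofs.continuous_frobeniusNormSq.comp_continuousOn cDu
      exact (aestronglyMeasurable_prod_of_continuousOn cG).aemeasurable.ennreal_ofReal.lintegral_prod_right'
    -- the slice bound, for a.e. `τ ∈ (s, t)` and every `ε > 0`, `n`
    have hae' : ∀ᵐ τ ∂(volume.restrict (Ioo s t)), ∀ x,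
        p τ x = normalisedPressure (u τ) x + forcePotential (f τ) x + Cp τ :=
      ae_restrict_of_ae_restrict_of_subset (Ioo_subset_Icc_self.trans (Icc_subset_Icc hs ht)) hae
    have hslice : ∀ {ε : ℝ} (_ : 0 < ε) (n : ℕ), ∀ᵐ τ ∂(volume.restrict (Ioo s t)),
        ‖∫ x, p τ x * fderiv ℝ (φ n) x (u τ x)‖ₑ ≤
          ENNReal.ofReal ε * G τ +
            (ENNReal.ofReal (C₅ * (ε * Ar ^ 2 / ((n : ℝ) + 1) ^ 2 + Ar ^ 6 / (ε ^ 3 * ((n : ℝ) + 1) ^ 4))) +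
              KΦ * Gf n τ) := by
      intro ε hε n
      filter_upwards [hae', ae_restrict_mem measurableSet_Ioo] with τ hτ hτm
      have hτI := hIcc hτm
      have hv := h.contDiff_velocity hτI
      have hv1 : ContDiff ℝ 1 (u τ) := hv.of_le (by norm_cast)
      have hr : (0 : ℝ) < (n : ℝ) + 1 := hRpos n
      have hR4 : (0 : ℝ) < 4 * ((n : ℝ) + 1) := by positivity
      -- the force-potential pairing is integrable (continuous potential, compactly supported weight)
      have hfτc : Continuous (f τ) := h.continuous_force_slice hU hτI
      have hfτ : ContDiff ℝ 2 (f τ) := contDiff_infty.1 (hfs.contDiff_slice hτI) 2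
      have hfM : MemLp (f τ) 2 volume :=
        memLp_two_of_lintegral_lt_top hfτc ((hCf τ hτI).trans_lt hCft.lt_top)
      have hΦc : Continuous (forcePotential (f τ)) := (contDiff_forcePotential hfτ hfM).continuous
      have hD : Continuous fun x => fderiv ℝ (φ n) x (u τ x) :=
        ((hφ1 n).continuous_fderiv one_ne_zero).clm_apply hv.continuous
      have hDc : HasCompactSupport fun x => fderiv ℝ (φ n) x (u τ x) := by
        refine ((hφc n).fderiv ℝ).mono fun x hx => ?_
        rw [Function.mem_support] at hx ⊢
        contrapose! hx
        rw [hx]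
        rfl
      have hπi : Integrable fun x => forcePotential (f τ) x * fderiv ℝ (φ n) x (u τ x) :=
        (hΦc.mul hD).integrable_of_hasCompactSupport hDc.mul_left
      have heq := integral_forcedPressure_shift_eq hv1 (h.divFree τ hτI) (hφ1 n) (hφc n)
        (h.contDiff_pressure hτI).continuous hπi hτ
      -- the `p̃` part by `X₅`
      have h5' := h5 (u τ) hv Ar hAr0 (by rw [hAr2]; exact hA τ hτI) (4 * ((n : ℝ) + 1)) ((n : ℝ) + 1)
        hr (by linarith) ε hε
      have h5'' : |∫ x, normalisedPressure (u τ) x * fderiv ℝ (φ n) x (u τ x)| ≤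
          ε * localisedDissipation (φ n) (u τ) +
            C₅ * (ε * Ar ^ 2 / ((n : ℝ) + 1) ^ 2 + Ar ^ 6 / (ε ^ 3 * ((n : ℝ) + 1) ^ 4)) := h5'
      have hX : ENNReal.ofReal (localisedDissipation (φ n) (u τ)) ≤ G τ :=
        ofReal_localisedDissipation_le hv1 (hφ1 n).continuous (hφc n)
          (fun x => taoCutoff_pow_nonneg _ _ x 8) (fun x => taoCutoff_pow_le_one _ _ x 8)
      have hX0 : 0 ≤ ε * localisedDissipation (φ n) (u τ) :=
        mul_nonneg hε.le (localisedDissipation_nonneg (fun x => taoCutoff_pow_nonneg _ _ x 8) _)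
      have hA1 : ‖∫ x, normalisedPressure (u τ) x * fderiv ℝ (φ n) x (u τ x)‖ₑ ≤
          ENNReal.ofReal ε * G τ +
            ENNReal.ofReal (C₅ * (ε * Ar ^ 2 / ((n : ℝ) + 1) ^ 2 + Ar ^ 6 / (ε ^ 3 * ((n : ℝ) + 1) ^ 4))) := by
        rw [Real.enorm_eq_ofReal_abs]
        refine (ENNReal.ofReal_le_ofReal h5'').trans ?_
        rw [ENNReal.ofReal_add hX0 (by positivity), ENNReal.ofReal_mul hε.le]
        gcongr
      -- the `Δ⁻¹∇·f` part by the HLS tail bound (the shell of `φ_n` has radii `R = 4(n+1)`, `r = n+1`)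
      have hΦe := enorm_integral_forcePotential_mul_fderiv_cutoff_le hfτc hv.continuous hAr0
        (by rw [hAr2]; exact hA τ hτI) hR4 hr (hC₁ _ _ hr hR4) hC₁0.le
      have e1 : 8 * (C₁ / ((n : ℝ) + 1)) * (unitSphereArea (EuclideanSpace ℝ (Fin 3)))⁻¹ *
          (4 * ((n : ℝ) + 1)) * Ar = 32 * C₁ * (unitSphereArea (EuclideanSpace ℝ (Fin 3)))⁻¹ * Ar := by
        field_simp
        ring
      have hA2 : ‖∫ x, forcePotential (f τ) x * fderiv ℝ (φ n) x (u τ x)‖ₑ ≤ KΦ * Gf n τ := by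
        refine hΦe.trans_eq ?_
        rw [e1]
      rw [heq]
      refine (enorm_add_le _ _).trans ?_
      calc ‖∫ x, normalisedPressure (u τ) x * fderiv ℝ (φ n) x (u τ x)‖ₑ +
            ‖∫ x, forcePotential (f τ) x * fderiv ℝ (φ n) x (u τ x)‖ₑ
          ≤ (ENNReal.ofReal ε * G τ +
              ENNReal.ofReal (C₅ * (ε * Ar ^ 2 / ((n : ℝ) + 1) ^ 2 + Ar ^ 6 / (ε ^ 3 * ((n : ℝ) + 1) ^ 4)))) +
              KΦ * Gf n τ := add_le_add hA1 hA2
        _ = ENNReal.ofReal ε * G τ +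
            (ENNReal.ofReal (C₅ * (ε * Ar ^ 2 / ((n : ℝ) + 1) ^ 2 + Ar ^ 6 / (ε ^ 3 * ((n : ℝ) + 1) ^ 4))) +
              KΦ * Gf n τ) := add_assoc _ _ _
    -- hence the bound on the time integral (when the tail functional is finite)
    have hbound : ∀ {ε : ℝ} (_ : 0 < ε) (n : ℕ), Ψ n ≠ ⊤ →
        |∫ τ in Ioo s t, ∫ x, p τ x * fderiv ℝ (φ n) x (u τ x)| ≤
          ε * Dst.toReal +
            C₅ * (ε * Ar ^ 2 / ((n : ℝ) + 1) ^ 2 + Ar ^ 6 / (ε ^ 3 * ((n : ℝ) + 1) ^ 4)) * (t - s) +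
              (KΦ * Ψ n).toReal := by
      intro ε hε n hΨn
      set K₂ : ℝ := C₅ * (ε * Ar ^ 2 / ((n : ℝ) + 1) ^ 2 + Ar ^ 6 / (ε ^ 3 * ((n : ℝ) + 1) ^ 4)) with hK₂
      have hK₂0 : 0 ≤ K₂ := by positivity
      have hle : ∫⁻ τ in Ioo s t, ‖∫ x, p τ x * fderiv ℝ (φ n) x (u τ x)‖ₑ ≤
          ENNReal.ofReal ε * Dst + ENNReal.ofReal K₂ * volume (Ioo s t) + KΦ * Ψ n := by
        calc ∫⁻ τ in Ioo s t, ‖∫ x, p τ x * fderiv ℝ (φ n) x (u τ x)‖ₑ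
            ≤ ∫⁻ τ in Ioo s t, (ENNReal.ofReal ε * G τ + (ENNReal.ofReal K₂ + KΦ * Gf n τ)) :=
              lintegral_mono_ae (hslice hε n)
          _ = ENNReal.ofReal ε * Dst +
                (ENNReal.ofReal K₂ * volume (Ioo s t) + KΦ * ∫⁻ τ in Ioo s t, Gf n τ) := by
              rw [lintegral_add_left' (hGm.const_mul _), lintegral_const_mul' _ _ ENNReal.ofReal_ne_top,
                lintegral_add_left measurable_const, setLIntegral_const, lintegral_const_mul' _ _ hKΦt]
          _ ≤ ENNReal.ofReal ε * Dst + (ENNReal.ofReal K₂ * volume (Ioo s t) + KΦ * Ψ n) := by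
              gcongr
              exact lintegral_Ioo_mono hs ht
          _ = ENNReal.ofReal ε * Dst + ENNReal.ofReal K₂ * volume (Ioo s t) + KΦ * Ψ n :=
              (add_assoc _ _ _).symm
      have hfin12 : ENNReal.ofReal ε * Dst + ENNReal.ofReal K₂ * volume (Ioo s t) ≠ ⊤ := by
        rw [Real.volume_Ioo]
        exact ENNReal.add_ne_top.2 ⟨ENNReal.mul_ne_top ENNReal.ofReal_ne_top hDst,
          ENNReal.mul_ne_top ENNReal.ofReal_ne_top ENNReal.ofReal_ne_top⟩
      have hfin3 : KΦ * Ψ n ≠ ⊤ := ENNReal.mul_ne_top hKΦt hΨn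
      have hfin : ENNReal.ofReal ε * Dst + ENNReal.ofReal K₂ * volume (Ioo s t) + KΦ * Ψ n ≠ ⊤ :=
        ENNReal.add_ne_top.2 ⟨hfin12, hfin3⟩
      have h1 : ‖∫ τ in Ioo s t, ∫ x, p τ x * fderiv ℝ (φ n) x (u τ x)‖ ≤
          (ENNReal.ofReal ε * Dst + ENNReal.ofReal K₂ * volume (Ioo s t) + KΦ * Ψ n).toReal := by
        refine (norm_integral_le_lintegral_norm _).trans (ENNReal.toReal_mono hfin ?_)
        refine le_trans (lintegral_mono fun τ => ?_) hle
        rw [ofReal_norm]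
      rw [Real.norm_eq_abs] at h1
      refine h1.trans_eq ?_
      rw [ENNReal.toReal_add hfin12 hfin3, Real.volume_Ioo,
        ENNReal.toReal_add (ENNReal.mul_ne_top ENNReal.ofReal_ne_top hDst)
          (ENNReal.mul_ne_top ENNReal.ofReal_ne_top ENNReal.ofReal_ne_top),
        ENNReal.toReal_mul, ENNReal.toReal_mul, ENNReal.toReal_ofReal hε.le, ENNReal.toReal_ofReal hK₂0,
        ENNReal.toReal_ofReal (by linarith)]
    -- and the limit
    rw [Metric.tendsto_nhds]
    intro δ hδ
    set ε : ℝ := δ / (3 * (Dst.toReal + 1)) with hεdef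
    have hD0 : 0 ≤ Dst.toReal := ENNReal.toReal_nonneg
    have hε : 0 < ε := by positivity
    have hεD : ε * Dst.toReal ≤ δ / 3 := by
      rw [hεdef, div_mul_eq_mul_div, div_le_iff₀ (by positivity)]
      nlinarith
    have hsecond : Tendsto (fun n : ℕ =>
        C₅ * (ε * Ar ^ 2 / ((n : ℝ) + 1) ^ 2 + Ar ^ 6 / (ε ^ 3 * ((n : ℝ) + 1) ^ 4)) * (t - s))
        atTop (𝓝 0) := by
      have h0 : Tendsto (fun n : ℕ => (1 : ℝ) / ((n : ℝ) + 1)) atTop (𝓝 0) :=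
        tendsto_one_div_add_atTop_nhds_zero_nat
      have e : ∀ n : ℕ, C₅ * (ε * Ar ^ 2 / ((n : ℝ) + 1) ^ 2 + Ar ^ 6 / (ε ^ 3 * ((n : ℝ) + 1) ^ 4)) * (t - s) =
          C₅ * (ε * Ar ^ 2 * (1 / ((n : ℝ) + 1)) ^ 2 + Ar ^ 6 / ε ^ 3 * (1 / ((n : ℝ) + 1)) ^ 4) *
            (t - s) := by
        intro n
        have : (n : ℝ) + 1 ≠ 0 := (hRpos n).ne'
        field_simp
      simp_rw [e]
      have := ((((h0.pow 2).const_mul (ε * Ar ^ 2)).add ((h0.pow 4).const_mul (Ar ^ 6 / ε ^ 3))).const_mul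
        C₅).mul_const (t - s)
      simpa using this
    have hthird : Tendsto (fun n : ℕ => (KΦ * Ψ n).toReal) atTop (𝓝 0) := by
      have h1 : Tendsto (fun n => KΦ * Ψ n) atTop (𝓝 0) := by
        have := ENNReal.Tendsto.const_mul hΨ0 (Or.inr hKΦt)
        simpa using this
      have h2 := (ENNReal.tendsto_toReal ENNReal.zero_ne_top).comp h1
      rw [ENNReal.toReal_zero] at h2
      exact h2
    have hev1 : ∀ᶠ n : ℕ in atTop,
        |C₅ * (ε * Ar ^ 2 / ((n : ℝ) + 1) ^ 2 + Ar ^ 6 / (ε ^ 3 * ((n : ℝ) + 1) ^ 4)) * (t - s)| < δ / 3 := by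
      have h2 := hsecond
      rw [Metric.tendsto_nhds] at h2
      simpa only [dist_zero_right, Real.norm_eq_abs] using h2 (δ / 3) (by positivity)
    have hev2 : ∀ᶠ n : ℕ in atTop, |(KΦ * Ψ n).toReal| < δ / 3 := by
      have h2 := hthird
      rw [Metric.tendsto_nhds] at h2
      simpa only [dist_zero_right, Real.norm_eq_abs] using h2 (δ / 3) (by positivity)
    have hev3 : ∀ᶠ n : ℕ in atTop, Ψ n < ⊤ := by
      filter_upwards [hΨ0.eventually (eventually_lt_nhds zero_lt_one)] with n hn
      exact hn.trans ENNReal.one_lt_top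
    filter_upwards [hev1, hev2, hev3] with n hn1 hn2 hn3
    rw [dist_zero_right, Real.norm_eq_abs]
    calc |∫ τ in Ioo s t, ∫ x, p τ x * fderiv ℝ (φ n) x (u τ x)|
        ≤ ε * Dst.toReal +
            C₅ * (ε * Ar ^ 2 / ((n : ℝ) + 1) ^ 2 + Ar ^ 6 / (ε ^ 3 * ((n : ℝ) + 1) ^ 4)) * (t - s) +
              (KΦ * Ψ n).toReal := hbound hε n hn3.ne
      _ < δ := by
          linarith [le_abs_self (C₅ * (ε * Ar ^ 2 / ((n : ℝ) + 1) ^ 2 +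
            Ar ^ 6 / (ε ^ 3 * ((n : ℝ) + 1) ^ 4)) * (t - s)), le_abs_self ((KΦ * Ψ n).toReal)]
  -- (e) the dissipation `ν ∫∫ φ |∇u|² → ν ∫∫ |∇u|²` (dominated convergence on `(s, t) × ℝ³`)
  set μ : Measure (ℝ × EuclideanSpace ℝ (Fin 3)) :=
    ((volume : Measure ℝ).restrict (Ioo s t)).prod (volume : Measure (EuclideanSpace ℝ (Fin 3)))
    with hμ
  have lim2 : Tendsto (fun n => ∫ τ in Ioo s t, ∫ x, φ n x * frobeniusNormSq (fderiv ℝ (u τ) x))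
      atTop (𝓝 ((∫⁻ τ in Ioo s t, ∫⁻ x,
        ENNReal.ofReal (frobeniusNormSq (fderiv ℝ (u τ) x))).toReal)) := by
    have cG : ContinuousOn (fun z : ℝ × EuclideanSpace ℝ (Fin 3) =>
        frobeniusNormSq (fderiv ℝ (u z.1) z.2)) (Icc s t ×ˢ univ) :=
      LerayHopfProofs.continuous_frobeniusNormSq.comp_continuousOn cDu
    have hGi : Integrable (fun z : ℝ × EuclideanSpace ℝ (Fin 3) =>
        frobeniusNormSq (fderiv ℝ (u z.1) z.2)) μ := by
      refine integrable_prod_of_continuousOn_of_lintegral cG ?_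
      calc ∫⁻ τ in Ioo s t, ∫⁻ x, ‖frobeniusNormSq (fderiv ℝ (u τ) x)‖ₑ
          = ∫⁻ τ in Ioo s t, ∫⁻ x, ENNReal.ofReal (frobeniusNormSq (fderiv ℝ (u τ) x)) := by
            simp only [Real.enorm_eq_ofReal (frobeniusNormSq_nonneg _)]
        _ ≤ ∫⁻ τ in Ioo 0 T, ∫⁻ x, ENNReal.ofReal (frobeniusNormSq (fderiv ℝ (u τ) x)) :=
            lintegral_Ioo_mono hs ht
        _ < ⊤ := hgrad
    have hFn : ∀ n, Integrable (fun z : ℝ × EuclideanSpace ℝ (Fin 3) =>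
        φ n z.2 * frobeniusNormSq (fderiv ℝ (u z.1) z.2)) μ := fun n =>
      hGi.mono' (aestronglyMeasurable_prod_of_continuousOn
        ((((hφ1 n).continuous.comp continuous_snd).continuousOn).mul cG))
        (Eventually.of_forall fun z => by
          rw [norm_mul, Real.norm_eq_abs, Real.norm_of_nonneg (frobeniusNormSq_nonneg _)]
          exact mul_le_of_le_one_left (frobeniusNormSq_nonneg _) (hφle n _))
    have hval : ∀ n, ∫ τ in Ioo s t, ∫ x, φ n x * frobeniusNormSq (fderiv ℝ (u τ) x) =
        ∫ z, φ n z.2 * frobeniusNormSq (fderiv ℝ (u z.1) z.2) ∂μ := fun n =>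
      (integral_prod _ (hFn n)).symm
    have hlimval : (∫⁻ τ in Ioo s t, ∫⁻ x, ENNReal.ofReal (frobeniusNormSq (fderiv ℝ (u τ) x))).toReal
        = ∫ z, frobeniusNormSq (fderiv ℝ (u z.1) z.2) ∂μ := by
      rw [integral_eq_lintegral_of_nonneg_ae (Eventually.of_forall fun z => frobeniusNormSq_nonneg _)
        hGi.aestronglyMeasurable, lintegral_prod _ hGi.aestronglyMeasurable.aemeasurable.ennreal_ofReal]
    rw [hlimval]
    refine (tendsto_integral_of_dominated_convergence
      (fun z : ℝ × EuclideanSpace ℝ (Fin 3) => frobeniusNormSq (fderiv ℝ (u z.1) z.2))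
      (fun n => (hFn n).aestronglyMeasurable) hGi (fun n => Eventually.of_forall fun z => ?_)
      (Eventually.of_forall fun z => ?_)).congr fun n => (hval n).symm
    · rw [norm_mul, Real.norm_eq_abs, Real.norm_of_nonneg (frobeniusNormSq_nonneg _)]
      exact mul_le_of_le_one_left (frobeniusNormSq_nonneg _) (hφle n _)
    · simpa using (hφlim z.2).mul_const (frobeniusNormSq (fderiv ℝ (u z.1) z.2))
  -- (f) the force term `∫∫ φ ⟪f, u⟫ → ∫∫ ⟪f, u⟫` (dominated convergence on `(s, t) × ℝ³`)
  have lim5 : Tendsto (fun n => ∫ τ in Ioo s t, ∫ x, φ n x * ⟪f τ x, u τ x⟫)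
      atTop (𝓝 (∫ τ in Ioo s t, ∫ x, ⟪f τ x, u τ x⟫)) := by
    have cF : ContinuousOn (fun z : ℝ × EuclideanSpace ℝ (Fin 3) => ⟪f z.1 z.2, u z.1 z.2⟫)
        (Icc s t ×ˢ univ) := cf.inner cu
    set CA : ℝ≥0∞ := Cf ^ (1 / 2 : ℝ) * A ^ (1 / 2 : ℝ) with hCA
    have hCAt : CA ≠ ⊤ := ENNReal.mul_ne_top (ENNReal.rpow_ne_top_of_nonneg (by norm_num) hCft)
      (ENNReal.rpow_ne_top_of_nonneg (by norm_num) hAt)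
    have hFi : Integrable (fun z : ℝ × EuclideanSpace ℝ (Fin 3) => ⟪f z.1 z.2, u z.1 z.2⟫) μ := by
      refine integrable_prod_of_continuousOn_of_lintegral cF ?_
      calc ∫⁻ τ in Ioo s t, ∫⁻ x, ‖⟪f τ x, u τ x⟫‖ₑ
          ≤ ∫⁻ τ in Ioo s t, ∫⁻ x, ‖f τ x‖ₑ * ‖u τ x‖ₑ := by
            refine lintegral_mono fun τ => lintegral_mono fun x => ?_
            rw [← ofReal_norm, ← ofReal_norm, ← ofReal_norm, ← ENNReal.ofReal_mul (norm_nonneg _)]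
            exact ENNReal.ofReal_le_ofReal (norm_inner_le_norm _ _)
        _ ≤ ∫⁻ τ in Ioo s t, CA := by
            refine setLIntegral_mono' measurableSet_Ioo fun τ hτ => ?_
            have hτI := hIcc hτ
            exact lintegral_enorm_force_mul_enorm_le (h.continuous_force_slice hU hτI)
              (h.contDiff_velocity hτI).continuous (hCf τ hτI) (hA τ hτI)
        _ = CA * volume (Ioo s t) := setLIntegral_const _ _
        _ < ⊤ := by
            rw [Real.volume_Ioo]; exact ENNReal.mul_lt_top hCAt.lt_top ENNReal.ofReal_lt_top
    have hFn : ∀ n, Integrable (fun z : ℝ × EuclideanSpace ℝ (Fin 3) =>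
        φ n z.2 * ⟪f z.1 z.2, u z.1 z.2⟫) μ := fun n =>
      hFi.norm.mono' (aestronglyMeasurable_prod_of_continuousOn
        ((((hφ1 n).continuous.comp continuous_snd).continuousOn).mul cF))
        (Eventually.of_forall fun z => by
          rw [norm_mul, Real.norm_eq_abs, Real.norm_eq_abs]
          exact mul_le_of_le_one_left (abs_nonneg _) (hφle n _))
    have hval : ∀ n, ∫ τ in Ioo s t, ∫ x, φ n x * ⟪f τ x, u τ x⟫ =
        ∫ z, φ n z.2 * ⟪f z.1 z.2, u z.1 z.2⟫ ∂μ := fun n => (integral_prod _ (hFn n)).symm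
    have hlimval : ∫ τ in Ioo s t, ∫ x, ⟪f τ x, u τ x⟫ = ∫ z, ⟪f z.1 z.2, u z.1 z.2⟫ ∂μ :=
      (integral_prod _ hFi).symm
    rw [hlimval]
    refine (tendsto_integral_of_dominated_convergence
      (fun z : ℝ × EuclideanSpace ℝ (Fin 3) => ‖⟪f z.1 z.2, u z.1 z.2⟫‖)
      (fun n => (hFn n).aestronglyMeasurable) hFi.norm (fun n => Eventually.of_forall fun z => ?_)
      (Eventually.of_forall fun z => ?_)).congr fun n => (hval n).symm
    · rw [norm_mul, Real.norm_eq_abs, Real.norm_eq_abs]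
      exact mul_le_of_le_one_left (abs_nonneg _) (hφle n _)
    · simpa using (hφlim z.2).mul_const (⟪f z.1 z.2, u z.1 z.2⟫)
  -- (g) pass to the limit in the identity
  have hLHS := (limE htI).sub (limE hsI)
  have hRHS := ((((lim1.const_mul (2⁻¹ : ℝ)).sub (lim2.const_mul ν)).sub (lim3.const_mul ν)).add
    lim4).add lim5
  have heq := tendsto_nhds_unique hLHS (hRHS.congr fun n => (hid n).symm)
  linarith

end Energy

/-! ## 3. Leray–Hopf packaging without the potential hypothesis -/

section Assembly

variable {T ν : ℝ} {f u : ℝ → EuclideanSpace ℝ (Fin 3) → EuclideanSpace ℝ (Fin 3)}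
  {p : ℝ → EuclideanSpace ℝ (Fin 3) → ℝ}

/-- The force integral of the localised balance over `(s, t)` is the interval integral
`∫ τ in s..t` of `IsLerayHopfOn` (`s ≤ t`). [folklore] -/
private theorem intervalIntegral_eq_integral_Ioo' {g : ℝ → ℝ} {s t : ℝ} (hst : s ≤ t) :
    ∫ τ in s..t, g τ = ∫ τ in Ioo s t, g τ := by
  rw [intervalIntegral.integral_of_le hst, integral_Ioc_eq_integral_Ioo]

/-- **Finite energy classical solutions of FORCED Navier–Stokes are Leray–Hopf solutions — core
statement, general force class (no potential hypothesis).** A classical solution of the forced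
system on `[0, T] × ℝ³` (`ν > 0`) with `sup_t ∫|u(t)|² ≤ A < ∞`, `∇u ∈ L²_{t,x}` and force slices
`∫|f(t)|² ≤ C_f < ∞` is a Leray–Hopf weak solution on `[0, T)` from `u(0)` WITH force `f` (energy
*equality* with the work term `∫⟪f,u⟫` from every time), and `u ∈ C([0,T]; L²)`. Verbatim the
packaging `isLerayHopfOn_of_finiteEnergy_forced_ae'` of the tree, fed with
`energyEq_of_finiteEnergy_forced_L2`. [cite: Tao2011, Lemma 8.1 + Lemma 4.1 (i), with (9)] -/
theorem IsClassicalNSSolutionOn.isLerayHopfOn_of_finiteEnergy_forced_L2'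
    (h : IsClassicalNSSolutionOn (Icc 0 T) ν f u p) (hν : 0 < ν) (hT : 0 < T)
    {Cf : ℝ≥0∞} (hCft : Cf ≠ ⊤) (hCf : ∀ t ∈ Icc 0 T, ∫⁻ x, ‖f t x‖ₑ ^ 2 ≤ Cf)
    {A : ℝ≥0∞} (hAt : A ≠ ⊤) (hA : ∀ t ∈ Icc 0 T, ∫⁻ x, ‖u t x‖ₑ ^ 2 ≤ A)
    (hgrad : ∫⁻ τ in Ioo 0 T, ∫⁻ x, ENNReal.ofReal (frobeniusNormSq (fderiv ℝ (u τ) x)) < ⊤) :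
    IsLerayHopfOn T ν f (u 0) u ∧ ContinuousInLpOn (Icc 0 T) 2 u := by
  have h0I : (0 : ℝ) ∈ Icc 0 T := left_mem_Icc.2 hT.le
  have hfilter : 𝓝[>] (0 : ℝ) ≤ 𝓝[Icc 0 T] 0 :=
    nhdsWithin_le_of_mem (mem_of_superset (Ioo_mem_nhdsGT hT) Ioo_subset_Icc_self)
  have hu₃ := h.lintegral_enorm_pow_three_lt_top_forced hAt hA hgrad
  have hmem : ∀ t ∈ Icc 0 T, MemLp (u t) 2 volume := fun t ht =>
    memLp_two_of_lintegral_lt_top (h.contDiff_velocity ht).continuous ((hA t ht).trans_lt hAt.lt_top)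
  -- the forced energy equality on every `[s, t] ⊆ [0, T]`
  have hE : ∀ {s t : ℝ}, 0 ≤ s → s ≤ t → t ≤ T → VectorCalculus.kineticEnergy (u t) +
      ν * (∫⁻ τ in Ioo s t, ∫⁻ x, ENNReal.ofReal (frobeniusNormSq (fderiv ℝ (u τ) x))).toReal =
      VectorCalculus.kineticEnergy (u s) + ∫ τ in Ioo s t, ∫ x, ⟪f τ x, u τ x⟫ :=
    fun hs hst ht => h.energyEq_of_finiteEnergy_forced_L2 hν hT hCft hCf hAt hA hgrad hu₃ hs hst ht
  -- the force work is `O(t - s)`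
  set M : ℝ := (Cf ^ (1 / 2 : ℝ) * A ^ (1 / 2 : ℝ)).toReal with hMdef
  have hM0 : 0 ≤ M := ENNReal.toReal_nonneg
  have hEabs : ∀ {s t : ℝ}, 0 ≤ s → s ≤ t → t ≤ T → |VectorCalculus.kineticEnergy (u t) +
      ν * (∫⁻ τ in Ioo s t, ∫⁻ x, ENNReal.ofReal (frobeniusNormSq (fderiv ℝ (u τ) x))).toReal -
      VectorCalculus.kineticEnergy (u s)| ≤ M * (t - s) := by
    intro s t hs hst ht
    rw [hE hs hst ht, add_sub_cancel_left]
    exact h.abs_integral_inner_force_le hT hCft hCf hAt hA hs hst ht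
  -- continuity in `L²`
  have hKE : ∀ t₀ ∈ Icc 0 T, Tendsto (fun t => VectorCalculus.kineticEnergy (u t))
      (𝓝[Icc 0 T] t₀) (𝓝 (VectorCalculus.kineticEnergy (u t₀))) :=
    fun t₀ ht₀ => tendsto_kineticEnergy_of_energyIneq_forced hM0 hgrad hEabs ht₀
  have hweak : ∀ {w : EuclideanSpace ℝ (Fin 3) → EuclideanSpace ℝ (Fin 3)} (_ : MemLp w 2 volume)
      (t₀ : ℝ) (_ : t₀ ∈ Icc 0 T),
      Tendsto (fun t => ∫ x, ⟪u t x, w x⟫) (𝓝[Icc 0 T] t₀) (𝓝 (∫ x, ⟪u t₀ x, w x⟫)) :=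
    fun hw t₀ ht₀ => tendsto_integral_inner_of_continuousOn h.smooth_velocity.continuousOn hmem
      ENNReal.toReal_nonneg (fun t ht => toReal_eLpNorm_two_le hAt (hA t ht)) hw ht₀
  have hcont : ContinuousInLpOn (Icc 0 T) 2 u := continuousInLpOn_of_energy_of_weak hmem hKE hweak
  refine ⟨⟨IsClassicalNSSolutionOn.isWeakNSSolutionOn_holds h Subset.rfl, ⟨A.toNNReal, ?_⟩, hmem,
    ⟨fun t => fderiv ℝ (u t), ?_, hgrad, fun t ht => ?_, ?_⟩, fun w hw => ⟨?_, ?_⟩, ?_⟩, hcont⟩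
  · -- energy bound a.e. on `(0, T)`
    refine (ae_restrict_iff' measurableSet_Ioo).2 (Eventually.of_forall fun t ht => ?_)
    rw [ENNReal.coe_toNNReal hAt]
    exact hA t (Ioo_subset_Icc_self ht)
  · -- the classical gradient is a weak gradient
    exact (ae_restrict_iff' measurableSet_Ioo).2 (Eventually.of_forall fun t ht =>
      hasWeakGradient_fderiv_of_contDiff
        (contDiff_infty.1 (h.contDiff_velocity (Ioo_subset_Icc_self ht)) 1))
  · -- energy (in)equality from `0`, WITH the work of the force
    rw [intervalIntegral_eq_integral_Ioo' ht.1]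
    exact (hE le_rfl ht.1 ht.2).le
  · -- energy (in)equality from every `s ∈ (0, T)`
    exact (ae_restrict_iff' measurableSet_Ioo).2 (Eventually.of_forall fun s hs t ht => by
      rw [intervalIntegral_eq_integral_Ioo' ht.1]
      exact (hE hs.1.le ht.1 ht.2).le)
  · -- weak continuity on `(0, T]`
    intro t ht
    exact (hweak hw t (Ioc_subset_Icc_self ht)).mono_left (nhdsWithin_mono _ Ioc_subset_Icc_self)
  · -- weak attainment of the datum
    exact (hweak hw 0 h0I).mono_left hfilter
  · -- strong attainment of the datum
    exact (hcont.2 0 h0I).mono_left hfilter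

/-- **Finite energy classical solutions of FORCED Navier–Stokes with `L²` force slices are
Leray–Hopf — no fact hypothesis, no potential hypothesis.** A classical solution of the forced system
on `[0, T] × ℝ³` (`ν > 0`, `T > 0`) with `sup_t ∫|u(t)|² < ∞` and `∫|f(t)|² ≤ C_f < ∞` on `[0,T]` is a
Leray–Hopf weak solution on `[0,T)` from `u(0)` with force `f`, and `u ∈ C([0,T]; L²)`: dissipation by
Lemma 8.1 WITH force (`dissipation_lt_top_of_forceL2`, the tree's
`tao2011_forced_finiteEnergy_energyBound_holds`), then `isLerayHopfOn_of_finiteEnergy_forced_L2'`. This is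
the hypothesis `IsLerayHopfOn T ν f (u 0) u` of Tao's Prop. 9.1 WITH force
(`lintegral_eLpNorm_top_lt_top_forced`) for the general force class of Cor. 11.4.
[cite: Tao2011, Lemma 8.1 (arXiv Lemma 44) + Lemma 4.1 (i), with (6)–(9)] -/
theorem IsClassicalNSSolutionOn.isLerayHopfOn_of_finiteEnergy_forced_L2
    (h : IsClassicalNSSolutionOn (Icc 0 T) ν f u p) (hν : 0 < ν) (hT : 0 < T)
    {Cf : ℝ≥0∞} (hCft : Cf ≠ ⊤) (hCf : ∀ t ∈ Icc 0 T, ∫⁻ x, ‖f t x‖ₑ ^ 2 ≤ Cf)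
    (hfe : ∃ A : ℝ≥0∞, A < ⊤ ∧ ∀ t ∈ Icc 0 T, ∫⁻ x, ‖u t x‖ₑ ^ 2 ≤ A) :
    IsLerayHopfOn T ν f (u 0) u ∧ ContinuousInLpOn (Icc 0 T) 2 u := by
  have hgrad := h.dissipation_lt_top_of_forceL2 hν hT hCft hCf hfe
  obtain ⟨A, hAt, hA⟩ := hfe
  exact h.isLerayHopfOn_of_finiteEnergy_forced_L2' hν hT hCft hCf hAt.ne hA hgrad

/-- **The forced energy equality in the energy class, general force class**: under the same
hypotheses, `∇u ∈ L²_{t,x}` and `½‖u(t)‖₂² + ν∫ₛᵗ∫|∇u|² = ½‖u(s)‖₂² + ∫ₛᵗ∫⟪f,u⟫` for all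
`0 ≤ s ≤ t ≤ T` (no fact hypothesis, no potential hypothesis).
[cite: Tao2011, Lemma 8.1 (arXiv Lemma 44) + Lemma 4.1 (i)] -/
theorem IsClassicalNSSolutionOn.energyEq_of_finiteEnergy_forced_L2_of_energy
    (h : IsClassicalNSSolutionOn (Icc 0 T) ν f u p) (hν : 0 < ν) (hT : 0 < T)
    {Cf : ℝ≥0∞} (hCft : Cf ≠ ⊤) (hCf : ∀ t ∈ Icc 0 T, ∫⁻ x, ‖f t x‖ₑ ^ 2 ≤ Cf)
    {A : ℝ≥0∞} (hAt : A ≠ ⊤) (hA : ∀ t ∈ Icc 0 T, ∫⁻ x, ‖u t x‖ₑ ^ 2 ≤ A) :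
    (∫⁻ τ in Ioo 0 T, ∫⁻ x, ENNReal.ofReal (frobeniusNormSq (fderiv ℝ (u τ) x)) < ⊤) ∧
      ∀ {s t : ℝ}, 0 ≤ s → s ≤ t → t ≤ T → VectorCalculus.kineticEnergy (u t) +
        ν * (∫⁻ τ in Ioo s t, ∫⁻ x, ENNReal.ofReal (frobeniusNormSq (fderiv ℝ (u τ) x))).toReal =
        VectorCalculus.kineticEnergy (u s) + ∫ τ in Ioo s t, ∫ x, ⟪f τ x, u τ x⟫ := by
  have hgrad := h.dissipation_lt_top_of_forceL2 hν hT hCft hCf ⟨A, hAt.lt_top, hA⟩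
  exact ⟨hgrad, fun hs hst ht => h.energyEq_of_finiteEnergy_forced_L2 hν hT hCft hCf hAt hA hgrad
    (h.lintegral_enorm_pow_three_lt_top_forced hAt hA hgrad) hs hst ht⟩

end Assembly

end Literature.Analysis.FluidPDE

end
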